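import Literature.AlgebraicGeometry.ModuliOfAbelianVarieties.SiegelTransporterBounds
import HarnessLib

/-!
# Finiteness of the rational transporter `{γ ∈ GSp_δ(ℚ) | γ J′ γ⁻¹ = J, a⁻¹ γ a′ ∈ K_δ(N)}` ([Deligne 1971] proof of Prop. 1.15)

Topic `AlgebraicGeometry/ModuliOfAbelianVarieties`; namespace `Literature.AlgebraicGeometry.ModuliOfAbelianVarieties`.
Theorems only (no definition, no named fact, no instance, no `sorry`).

For `J, J′ ∈ S^± = C0pm δ`, `a, a′ ∈ GSp_δ(𝔸_{ℚ,f})` and any `N`, the set of rational similitudes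
`T = {γ ∈ GSp_δ(ℚ) | γ J′ γ⁻¹ = J, a⁻¹ γ a′ ∈ K_δ(N)}` is FINITE (`finite_setOf_conjAct_eq_and_mem`):
* the finite-adelic condition bounds the DENOMINATORS of the entries of `γ` and `γ⁻¹` (`γ = a k a′⁻¹`, `γ⁻¹ = a′k⁻¹a⁻¹`
  with `k, k⁻¹` integral; one natural number `d` clears the entries of `a, a⁻¹, a′, a′⁻¹`, ★ `SiegelTransporterBounds`);
* the real condition bounds the SIZE of the entries: with the positive definite `S = ±ᵗJ E_δ`, `S′ = ±ᵗJ′ E_δ` one has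
  `ᵗγ S γ = r S′` with `r > 0` (★ `exists_transpose_mul_mul_eq_smul_of_conjAct_eq`), and `r ≤ R₀` uniformly because `γ⁻¹`
  has an entry of absolute value `≥ 1/d²`; so `|γ_{ki}| ≤ B` (★ `exists_pos_forall_mul_sq_le_of_posDef`).
So `T` embeds (`γ ↦` its matrix) in a finite set of rational matrices.  This is the finiteness input F-i of the
injectivity step «un seul `q` sert pour une chaîne cofinale» in the proof of [Deligne1971TravauxShimura] Prop. 1.15
(p. 132) as run model-free for the Hodge-type embedding `U(H) × T₀ ↪ GSp_δ` (cell hodgecm-mathlib, row I-1′,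
`stub_S2inj` core; B-plan2 ruling 2026-08-28).  HC_CM is proved only modulo the 7 printed citations until rung 0 closes;
this file proves no cell binder.

## References
* [Deligne1971TravauxShimura] P. Deligne, *Travaux de Shimura*, Sém. Bourbaki 389 (1971), Prop. 1.15 p. 132.
* [Milne2005ShimuraVarieties] J. S. Milne, *Introduction to Shimura varieties* (2005), Prop. 3.5, Lemma 5.13 p. 57, §6 p. 68.
* [CasselsFrohlichANT1967] Cassels–Fröhlich, *Algebraic Number Theory*, Ch. II §14.
-/

noncomputable section

open Matrix NumberField IsDedekindDomain

namespace Literature.AlgebraicGeometry.ModuliOfAbelianVarieties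

open SiegelModuli

/-! ### §1. Finiteness of the transporter `{γ ∈ GSp_δ(ℚ) | γJ′γ⁻¹ = J, a⁻¹ γ a′ ∈ K_δ(N)}` -/

section Finite

variable {g : ℕ} {δ : Fin g → ℕ}

/-- **FINITENESS OF THE RATIONAL TRANSPORTER** ([Deligne 1971] proof of Prop. 1.15, the set in which «un seul `q`»
is chosen): for `J, J′ ∈ S^±`, `a, a′ ∈ GSp_δ(𝔸_{ℚ,f})` and any `N`, the set of `γ ∈ GSp_δ(ℚ)` with `γ J′ γ⁻¹ = J` and
`a⁻¹ γ a′ ∈ K_δ(N)` is finite: the entries of `γ, γ⁻¹` have a common denominator (`γ = a k a′⁻¹`, `k` integral) and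
are bounded (`ᵗγ S γ = r S′` for the definite `S = ±ᵗJE_δ`, `S′ = ±ᵗJ′E_δ`, with `0 < r ≤ R₀`).
[cite: Deligne1971TravauxShimura, proof of Prop. 1.15 p. 132] [cite: Milne2005ShimuraVarieties, Prop. 3.5 and Lemma 5.13 p. 57] -/
theorem finite_setOf_conjAct_eq_and_mem (N : ℕ) (J J' : C0pm δ) (a a' : gspFinAdelic δ) :
    {γ : gspRational δ | conjAct δ (gspRationalToReal δ γ) J' = J ∧
      (a⁻¹ * (gspRationalToFinAdelic δ γ * a') : gspFinAdelic δ) ∈ principalLevelSubgroup δ N}.Finite := by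
  classical
  rcases isEmpty_or_nonempty (Fin g ⊕ Fin g) with hn | hn
  · -- no indices: `GSp_δ(ℚ)` is a singleton
    haveI : Subsingleton (Matrix (Fin g ⊕ Fin g) (Fin g ⊕ Fin g) ℚ) :=
      inferInstanceAs (Subsingleton ((Fin g ⊕ Fin g) → (Fin g ⊕ Fin g) → ℚ))
    haveI : Subsingleton (GL (Fin g ⊕ Fin g) ℚ) := ⟨fun x y => Units.ext (Subsingleton.elim _ _)⟩
    exact Set.toFinite _
  obtain ⟨i₀⟩ := hn
  -- the common denominator of `a, a⁻¹, a′, a′⁻¹`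
  obtain ⟨d, hd0, hd⟩ := exists_nat_forall_mul_entry_mem_integralAdeles
    (a : GL (Fin g ⊕ Fin g) finAdeleQ) (a' : GL (Fin g ⊕ Fin g) finAdeleQ)
  have hd₂0 : d * d ≠ 0 := mul_ne_zero hd0 hd0
  -- the two positive definite forms
  obtain ⟨σ, hσ, hS⟩ := exists_sign_smul_posDef J
  obtain ⟨σ', hσ', hS'⟩ := exists_sign_smul_posDef J'
  set P : Matrix (Fin g ⊕ Fin g) (Fin g ⊕ Fin g) ℝ :=
    (J : Matrix (Fin g ⊕ Fin g) (Fin g ⊕ Fin g) ℝ)ᵀ * realTypeForm δ with hP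
  set P' : Matrix (Fin g ⊕ Fin g) (Fin g ⊕ Fin g) ℝ :=
    (J' : Matrix (Fin g ⊕ Fin g) (Fin g ⊕ Fin g) ℝ)ᵀ * realTypeForm δ with hP'
  set S : Matrix (Fin g ⊕ Fin g) (Fin g ⊕ Fin g) ℝ := σ • P with hSdef
  set S' : Matrix (Fin g ⊕ Fin g) (Fin g ⊕ Fin g) ℝ := σ' • P' with hS'def
  have hσσ : σ * σ = 1 := by rcases hσ with h | h <;> rw [h] <;> norm_num
  have hσσ' : σ' * σ' = 1 := by rcases hσ' with h | h <;> rw [h] <;> norm_num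
  obtain ⟨c, hc, hcS⟩ := exists_pos_forall_mul_sq_le_of_posDef hS
  obtain ⟨c', hc', hcS'⟩ := exists_pos_forall_mul_sq_le_of_posDef hS'
  set D : ℝ := ∑ i, S i i with hD
  set D' : ℝ := ∑ i, S' i i with hD'
  have hSle : ∀ i, S i i ≤ D := fun i =>
    Finset.single_le_sum (f := fun j => S j j) (fun j _ => (hS.diag_pos (i := j)).le) (Finset.mem_univ i)
  have hS'le : ∀ i, S' i i ≤ D' := fun i =>
    Finset.single_le_sum (f := fun j => S' j j) (fun j _ => (hS'.diag_pos (i := j)).le) (Finset.mem_univ i)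
  have hD'0 : 0 ≤ D' := Finset.sum_nonneg fun j _ => (hS'.diag_pos (i := j)).le
  set R₀ : ℝ := D * ((d * d : ℕ) : ℝ) ^ 2 / c' with hR₀
  set B : ℝ := Real.sqrt (R₀ * D' / c) with hB
  -- the key estimate: denominators `d²` and absolute values `≤ B`
  have key : ∀ γ : gspRational δ, (conjAct δ (gspRationalToReal δ γ) J' = J ∧
      (a⁻¹ * (gspRationalToFinAdelic δ γ * a') : gspFinAdelic δ) ∈ principalLevelSubgroup δ N) →
      ∀ k i, (∃ z : ℤ, (z : ℚ) = (d * d : ℕ) * ((γ : GL (Fin g ⊕ Fin g) ℚ) : Matrix (Fin g ⊕ Fin g) (Fin g ⊕ Fin g) ℚ) k i) ∧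
        |((((γ : GL (Fin g ⊕ Fin g) ℚ) : Matrix (Fin g ⊕ Fin g) (Fin g ⊕ Fin g) ℚ) k i : ℚ) : ℝ)| ≤ B := by
    rintro γ ⟨hJ, hk⟩
    -- (1) finite-adelic side: `γ = a k a′⁻¹`, `γ⁻¹ = a′ k⁻¹ a⁻¹` with `k, k⁻¹` integral
    set kk : gspFinAdelic δ := a⁻¹ * (gspRationalToFinAdelic δ γ * a') with hkk
    have hγf : gspRationalToFinAdelic δ γ = a * kk * a'⁻¹ := by rw [hkk]; group
    have hγf' : (gspRationalToFinAdelic δ γ)⁻¹ = a' * kk⁻¹ * a⁻¹ := by rw [hγf]; group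
    have hkint : ∀ p q, ((kk : GL (Fin g ⊕ Fin g) finAdeleQ) : Matrix (Fin g ⊕ Fin g) (Fin g ⊕ Fin g) finAdeleQ) p q ∈
        FiniteAdeleRing.integralAdeles (𝓞 ℚ) ℚ := fun p q => mem_integralAdeles_of_isCongOne hk.1 p q
    have hkint' : ∀ p q, (((kk⁻¹ : gspFinAdelic δ) : GL (Fin g ⊕ Fin g) finAdeleQ) : Matrix (Fin g ⊕ Fin g) (Fin g ⊕ Fin g) finAdeleQ) p q ∈
        FiniteAdeleRing.integralAdeles (𝓞 ℚ) ℚ := fun p q => mem_integralAdeles_of_isCongOne hk.2 p q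
    have hentry : ∀ k i, algebraMap ℚ finAdeleQ (((γ : GL (Fin g ⊕ Fin g) ℚ) : Matrix (Fin g ⊕ Fin g) (Fin g ⊕ Fin g) ℚ) k i) =
        (((a : GL (Fin g ⊕ Fin g) finAdeleQ) : Matrix (Fin g ⊕ Fin g) (Fin g ⊕ Fin g) finAdeleQ) *
          ((kk : GL (Fin g ⊕ Fin g) finAdeleQ) : Matrix (Fin g ⊕ Fin g) (Fin g ⊕ Fin g) finAdeleQ) *
          (((a'⁻¹ : gspFinAdelic δ) : GL (Fin g ⊕ Fin g) finAdeleQ) : Matrix (Fin g ⊕ Fin g) (Fin g ⊕ Fin g) finAdeleQ)) k i := by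
      intro k i
      have h1 : ((gspRationalToFinAdelic δ γ : GL (Fin g ⊕ Fin g) finAdeleQ) : Matrix (Fin g ⊕ Fin g) (Fin g ⊕ Fin g) finAdeleQ) k i =
          algebraMap ℚ finAdeleQ (((γ : GL (Fin g ⊕ Fin g) ℚ) : Matrix (Fin g ⊕ Fin g) (Fin g ⊕ Fin g) ℚ) k i) := by
        rw [coe_gspRationalToFinAdelic]
        exact Matrix.GeneralLinearGroup.map_apply (algebraMap ℚ finAdeleQ) k i _
      rw [← h1, hγf, Subgroup.coe_mul, Subgroup.coe_mul, Units.val_mul, Units.val_mul]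
    have hentry' : ∀ k i, algebraMap ℚ finAdeleQ ((((γ : GL (Fin g ⊕ Fin g) ℚ)⁻¹ : GL (Fin g ⊕ Fin g) ℚ) : Matrix (Fin g ⊕ Fin g) (Fin g ⊕ Fin g) ℚ) k i) =
        (((a' : GL (Fin g ⊕ Fin g) finAdeleQ) : Matrix (Fin g ⊕ Fin g) (Fin g ⊕ Fin g) finAdeleQ) *
          (((kk⁻¹ : gspFinAdelic δ) : GL (Fin g ⊕ Fin g) finAdeleQ) : Matrix (Fin g ⊕ Fin g) (Fin g ⊕ Fin g) finAdeleQ) *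
          (((a⁻¹ : gspFinAdelic δ) : GL (Fin g ⊕ Fin g) finAdeleQ) : Matrix (Fin g ⊕ Fin g) (Fin g ⊕ Fin g) finAdeleQ)) k i := by
      intro k i
      have h1 : ((((gspRationalToFinAdelic δ γ)⁻¹ : gspFinAdelic δ) : GL (Fin g ⊕ Fin g) finAdeleQ) : Matrix (Fin g ⊕ Fin g) (Fin g ⊕ Fin g) finAdeleQ) k i =
          algebraMap ℚ finAdeleQ ((((γ : GL (Fin g ⊕ Fin g) ℚ)⁻¹ : GL (Fin g ⊕ Fin g) ℚ) : Matrix (Fin g ⊕ Fin g) (Fin g ⊕ Fin g) ℚ) k i) := by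
        rw [← map_inv, coe_gspRationalToFinAdelic]
        exact Matrix.GeneralLinearGroup.map_apply (algebraMap ℚ finAdeleQ) k i _
      rw [← h1, hγf', Subgroup.coe_mul, Subgroup.coe_mul, Units.val_mul, Units.val_mul]
    have hden : ∀ k i, ∃ z : ℤ, (z : ℚ) = (d * d : ℕ) * ((γ : GL (Fin g ⊕ Fin g) ℚ) : Matrix (Fin g ⊕ Fin g) (Fin g ⊕ Fin g) ℚ) k i := by
      intro k i
      apply exists_int_cast_eq_mul_of_mem_integralAdeles
      rw [hentry]
      exact mul_entry_mul_mul_mem_integralAdeles (hd _ (Or.inl rfl)) hkint (hd _ (Or.inr (Or.inr (Or.inr rfl)))) k i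
    have hden' : ∀ k i, ∃ z : ℤ, (z : ℚ) =
        (d * d : ℕ) * ((((γ : GL (Fin g ⊕ Fin g) ℚ)⁻¹ : GL (Fin g ⊕ Fin g) ℚ) : Matrix (Fin g ⊕ Fin g) (Fin g ⊕ Fin g) ℚ) k i) := by
      intro k i
      apply exists_int_cast_eq_mul_of_mem_integralAdeles
      rw [hentry']
      exact mul_entry_mul_mul_mem_integralAdeles (hd _ (Or.inr (Or.inr (Or.inl rfl)))) hkint' (hd _ (Or.inr (Or.inl rfl))) k i
    -- (2) real side
    set M : Matrix (Fin g ⊕ Fin g) (Fin g ⊕ Fin g) ℝ :=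
      (((γ : GL (Fin g ⊕ Fin g) ℚ) : Matrix (Fin g ⊕ Fin g) (Fin g ⊕ Fin g) ℚ).map (algebraMap ℚ ℝ)) with hM
    set Mi : Matrix (Fin g ⊕ Fin g) (Fin g ⊕ Fin g) ℝ :=
      ((((γ : GL (Fin g ⊕ Fin g) ℚ)⁻¹ : GL (Fin g ⊕ Fin g) ℚ) : Matrix (Fin g ⊕ Fin g) (Fin g ⊕ Fin g) ℚ).map (algebraMap ℚ ℝ)) with hMi
    have hMMi : M * Mi = 1 := by
      rw [hM, hMi, ← Matrix.map_mul, ← Units.val_mul, mul_inv_cancel, Units.val_one,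
        Matrix.map_one _ (map_zero _) (map_one _)]
    have hMiM : Mi * M = 1 := by
      rw [hM, hMi, ← Matrix.map_mul, ← Units.val_mul, inv_mul_cancel, Units.val_one,
        Matrix.map_one _ (map_zero _) (map_one _)]
    obtain ⟨ν, hν⟩ := exists_transpose_mul_mul_eq_smul_of_conjAct_eq γ J J' hJ
    have hν' : Mᵀ * P * M = (ν : ℝ) • P' := by rw [hP, hP', hM]; exact hν
    set r : ℝ := σ * (ν : ℝ) * σ' with hr
    have hMSM : Mᵀ * S * M = r • S' := by
      calc Mᵀ * S * M = σ • (Mᵀ * P * M) := by rw [hSdef, Matrix.mul_smul, Matrix.smul_mul]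
        _ = (σ * (ν : ℝ)) • P' := by rw [hν', smul_smul]
        _ = (σ * (ν : ℝ) * (σ' * σ')) • P' := by rw [hσσ', mul_one]
        _ = r • S' := by rw [hS'def, smul_smul, hr]; congr 1; ring
    -- `r > 0`
    have hrpos : 0 < r := by
      set x : Fin g ⊕ Fin g → ℝ := Pi.single i₀ 1 with hx
      have hx0 : x ≠ 0 := by
        intro h; have := congrFun h i₀; simp [hx] at this
      have hMx : M *ᵥ x ≠ 0 := by
        intro h
        have h2 : Mi *ᵥ (M *ᵥ x) = x := by rw [Matrix.mulVec_mulVec, hMiM, Matrix.one_mulVec]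
        rw [h, Matrix.mulVec_zero] at h2
        exact hx0 h2.symm
      have h1 : (M *ᵥ x) ⬝ᵥ (S *ᵥ (M *ᵥ x)) = r * (x ⬝ᵥ (S' *ᵥ x)) := by
        rw [Matrix.mulVec_mulVec, Matrix.dotProduct_mulVec, Matrix.vecMul_mulVec, ← Matrix.mul_assoc, hMSM,
          ← Matrix.dotProduct_mulVec, Matrix.smul_mulVec, dotProduct_smul, smul_eq_mul]
      have h2 := hS.dotProduct_mulVec_pos hMx
      have h3 := hS'.dotProduct_mulVec_pos hx0
      rw [star_trivial] at h2 h3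
      rw [h1] at h2
      exact pos_of_mul_pos_left h2 h3.le
    -- the inverse relation
    have hMiSMi : Miᵀ * S' * Mi = r⁻¹ • S := by
      have h1 : S' = r⁻¹ • (Mᵀ * S * M) := by rw [hMSM, smul_smul, inv_mul_cancel₀ hrpos.ne', one_smul]
      rw [h1, Matrix.mul_smul, Matrix.smul_mul]
      congr 1
      calc Miᵀ * (Mᵀ * S * M) * Mi = (M * Mi)ᵀ * S * (M * Mi) := by
            simp only [Matrix.transpose_mul, Matrix.mul_assoc]
        _ = S := by rw [hMMi, Matrix.transpose_one, Matrix.one_mul, Matrix.mul_one]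
    have hbM : ∀ k i, c * (M k i) ^ 2 ≤ r * S' i i := mul_sq_entry_le_of_transpose_mul_mul_eq hcS hMSM
    have hbMi : ∀ k i, c' * (Mi k i) ^ 2 ≤ r⁻¹ * S i i := mul_sq_entry_le_of_transpose_mul_mul_eq hcS' hMiSMi
    -- a non-zero entry of `Mi`, with denominator `d²`, bounds `r ≤ R₀`
    have hMi0 : ∃ k i, Mi k i ≠ 0 := by
      by_contra hall
      push Not at hall
      have h0 : Mi = 0 := Matrix.ext fun k i => hall k i
      have h1 := congrFun (congrFun hMiM i₀) i₀
      rw [h0, Matrix.zero_mul, Matrix.zero_apply, Matrix.one_apply_eq] at h1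
      exact zero_ne_one h1
    obtain ⟨k₁, i₁, hki⟩ := hMi0
    have hrle : r ≤ R₀ := by
      obtain ⟨z, hz⟩ := hden' k₁ i₁
      have hMie : Mi k₁ i₁ = (((((γ : GL (Fin g ⊕ Fin g) ℚ)⁻¹ : GL (Fin g ⊕ Fin g) ℚ) : Matrix (Fin g ⊕ Fin g) (Fin g ⊕ Fin g) ℚ) k₁ i₁ : ℚ) : ℝ) := by
        rw [hMi, Matrix.map_apply, eq_ratCast]
      have hzR : (z : ℝ) = ((d * d : ℕ) : ℝ) * Mi k₁ i₁ := by
        rw [hMie]; exact_mod_cast hz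
      have hz0 : z ≠ 0 := by
        rintro rfl
        rw [Int.cast_zero, eq_comm, mul_eq_zero] at hzR
        rcases hzR with h | h
        · exact hd₂0 (by exact_mod_cast h)
        · exact hki h
      have h1 : (1 : ℝ) ≤ ((d * d : ℕ) : ℝ) ^ 2 * (Mi k₁ i₁) ^ 2 := by
        have h2 : (1 : ℝ) ≤ |(z : ℝ)| := by exact_mod_cast Int.one_le_abs hz0
        rw [← mul_pow, ← hzR, one_le_sq_iff_one_le_abs]
        exact h2
      have h3 : r * (c' * (Mi k₁ i₁) ^ 2) ≤ D := by
        have h4 := mul_le_mul_of_nonneg_left ((hbMi k₁ i₁).trans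
          (mul_le_mul_of_nonneg_left (hSle i₁) (inv_nonneg.2 hrpos.le))) hrpos.le
        rwa [← mul_assoc r r⁻¹ D, mul_inv_cancel₀ hrpos.ne', one_mul] at h4
      rw [hR₀, le_div_iff₀ hc']
      calc r * c' = r * c' * 1 := (mul_one _).symm
        _ ≤ r * c' * (((d * d : ℕ) : ℝ) ^ 2 * (Mi k₁ i₁) ^ 2) :=
            mul_le_mul_of_nonneg_left h1 (mul_nonneg hrpos.le hc'.le)
        _ = ((d * d : ℕ) : ℝ) ^ 2 * (r * (c' * (Mi k₁ i₁) ^ 2)) := by ring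
        _ ≤ ((d * d : ℕ) : ℝ) ^ 2 * D := mul_le_mul_of_nonneg_left h3 (sq_nonneg _)
        _ = D * ((d * d : ℕ) : ℝ) ^ 2 := mul_comm _ _
    -- (3) the bound on the entries of `γ`
    intro k i
    refine ⟨hden k i, ?_⟩
    have hMki : M k i = ((((γ : GL (Fin g ⊕ Fin g) ℚ) : Matrix (Fin g ⊕ Fin g) (Fin g ⊕ Fin g) ℚ) k i : ℚ) : ℝ) := by
      rw [hM, Matrix.map_apply, eq_ratCast]
    rw [← hMki, hB]
    apply Real.abs_le_sqrt
    rw [le_div_iff₀ hc]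
    calc (M k i) ^ 2 * c = c * (M k i) ^ 2 := mul_comm _ _
      _ ≤ r * S' i i := hbM k i
      _ ≤ r * D' := mul_le_mul_of_nonneg_left (hS'le i) hrpos.le
      _ ≤ R₀ * D' := mul_le_mul_of_nonneg_right hrle hD'0
  -- conclusion: `γ ↦ (γ : Matrix)` is injective into a finite set of matrices
  have hfinA := finite_setOf_forall_entry_mem (m := Fin g ⊕ Fin g) (n := Fin g ⊕ Fin g)
    (finite_setOf_rat_den_le hd₂0 B)
  refine (hfinA.preimage (f := fun γ : gspRational δ => ((γ : GL (Fin g ⊕ Fin g) ℚ) : Matrix (Fin g ⊕ Fin g) (Fin g ⊕ Fin g) ℚ)) ?_).subset ?_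
  · intro x _ y _ hxy
    exact Subtype.ext (Units.ext hxy)
  · intro γ hγ
    exact fun k i => key γ hγ k i

end Finite

end Literature.AlgebraicGeometry.ModuliOfAbelianVarieties

end
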